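import Literature.MathematicalPhysics.QuantumFieldTheory.Balaban1983to89.Beta.ResolventComposition
import Literature.MathematicalPhysics.QuantumFieldTheory.Balaban1983to89.Beta.AveragingContoursRooted
import Literature.MathematicalPhysics.QuantumFieldTheory.Balaban1983to89.Beta.AffineReproduction

/-!
# `BalabanUV.Beta.CompositeAveragingCoarseExact` — binder row D1, work item K-U3b (re-scoped (Z)_m, R-D1-g24-2): **COMPOSITES OF ROOTED LINEAR AVERAGINGS
# DIFFER FROM THE STRAIGHT BLOCK-CONTOUR SUM OF THE PRODUCT BLOCKING BY A COARSE-EXACT FORM** — `linAvgAt ρ₁ (linAvgAt ρ₀ A M) L = contourSum (M·L) A − dz ζ`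
# with an explicit potential `ζ`, and the induction clause «a linear averaging with coarse-exact defect, followed by a rooted averaging, has a coarse-exact defect»
# (β sub-cell, BINDER-OWNERS row D1 OWNER, lineage an2 gen 24; the structural half of an3-g37's A2-ENGINE-TERMS §1 (i) ∕ §4 (5)(β); companion of K-U3a `RelInvCongruence`)

HONEST FRAMING (cell charter, verbatim): «discharging BetaPertH makes Balaban's UV stability UNCONDITIONAL — a real
constructive-QFT result; it is NOT the continuum limit and NOT the Clay problem.»
HONEST DEPENDENCY: continuum YM on T⁴ ⇐ BetaPertH ∧ nine spine estimates (0/9 proved); BetaPertH ⇐ (D1) ∧ (D4) ∧ CAP+tail;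
G-an2-4 gates asym, D1 and NE2/3/4.
ABSOLUTE RULE (cell, verbatim): «No internally-minted statement may enter as a cited fact. Every hypothesis is either kernel-proved in this
package or a verbatim quotation of a PUBLISHED theorem with page reference. The manuscript(s) under audit are NOT citable for their own
disputed steps — they are the thing under adjudication; programme-internal (2001/route/tribunal) claims are never citable.»
NOTHING below is cited: no `[cite: …]`, no `def`, no `Prop` fact.  Every declaration is [folklore] finite bookkeeping over the cell's OWN typed objects:
an1's rooted linear averaging `AveragingContoursRooted.linAvgAt ρ A L` (UNNORMALISED, `L^{d+1}·` the average) with its bridge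
`linAvgAt_eq_contourSum_sub_dz` (`= contourSum L A − dz (LamAt ρ A L)`), an2's straight block-contour sum `AffineAveraging.contourSum` with `contourSum_dz`
(averaging intertwines `dz`), `AffineReproduction.dz_add ∕ contourSum_sub`, and the semigroup law `ResolventComposition.contourSum_mul` (`contourSum (M·L) = contourSum L ∘ contourSum M`), BY NAME.  It asserts
nothing about Bałaban's objects beyond these typed linearisations at `U = 1`.

WHY (row-D1 owner, gen 24).  The composite one-shot object of record (a1*)_m (R-D1-g24-2, an3-g37 `A2-ENGINE-TERMS.v1.md` §4 (5)(α)) conjugates the straight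
co-dressed resolvent by a corrector `Ψ_m = 1 − Gd_f∘Ext_n∘ζ_m` built from the POTENTIAL `ζ_m` of the defect `dΦ^comp_m(𝟙) − contourSum n`; that such a potential
exists — the defect is COARSE-EXACT — is the content of this file (K-U3a `RelInvCongruence` is the conjugation half).  X-an3-30's first-order half («coarse-exact ✓»
numerically for the rooted 3∘3 pair) is here a kernel identity for every `M`, `L`, every pair of roots and every dimension.

WHAT (all [folklore]; `d` the lattice dimension, fields `Form1 d ℝ`, UNNORMALISED sums):
§1 `linAvgAt_eq` (the bridge as a 1-form identity), **`contourSum_linAvgAt`** (`contourSum L (linAvgAt ρ A M) = contourSum (M·L) A − dz (blockSum L (LamAt ρ A M))`).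
§2 **`linAvgAt_linAvgAt_eq`** (TWO LEVELS: `linAvgAt ρ₁ (linAvgAt ρ₀ A M) L = contourSum (M·L) A − dz (blockSum L (LamAt ρ₀ A M) + LamAt ρ₁ (linAvgAt ρ₀ A M) L)`).
§3 **`linAvgAt_of_coarseExact`** (INDUCTION CLAUSE: if `Φ A = contourSum N A − dz (ζ A)` then `linAvgAt ρ (Φ A) L = contourSum (N·L) A − dz (blockSum L (ζ A) + LamAt ρ (Φ A) L)`),
   **`contourSum_of_coarseExact`** (a STRAIGHT averaging on top keeps coarse-exactness: `contourSum L (Φ A) = contourSum (N·L) A − dz (blockSum L (ζ A))`).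
Provenance: β sub-cell, unit beta-an2 gen 24 (prover-b2b-balaban-beta-an2-g24-0), 2026-08-20.  NOT (SDF), NOT D1, NOT `BetaPertH`, NOT continuum, NOT Clay.
-/

namespace Summit.QuantumFields.BalabanUV.Beta.CompositeAveragingCoarseExact

open Literature.MathematicalPhysics.QuantumFieldTheory.Balaban1983to89.Beta
open AffineAveraging (Form0 Form1 dz blockSum contourSum contourSum_dz)
open AveragingContoursRooted (linAvgAt LamAt linAvgAt_eq_contourSum_sub_dz)
open ResolventComposition (contourSum_mul)
open AffineReproduction (dz_add contourSum_sub)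

variable {d : ℕ}

/-! ## §1 Linearity bookkeeping and the straight average of a rooted average -/

/-- [folklore] The rooted linear averaging as a 1-form identity: `linAvgAt ρ A M = contourSum M A − dz (LamAt ρ A M)`. -/
theorem linAvgAt_eq (ρ : Fin d → ℤ) (A : Form1 d ℝ) (M : ℕ) :
    (linAvgAt ρ A M : Form1 d ℝ) = contourSum M A - dz (LamAt ρ A M) := by
  funext μ y
  rw [Pi.sub_apply, Pi.sub_apply]
  exact linAvgAt_eq_contourSum_sub_dz ρ A M μ y

/-- [folklore] **THE STRAIGHT `L`-AVERAGE OF A ROOTED `M`-AVERAGE**: `contourSum L (linAvgAt ρ A M) = contourSum (M·L) A − dz (blockSum L (LamAt ρ A M))` (`0 < M`). -/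
theorem contourSum_linAvgAt (ρ : Fin d → ℤ) (A : Form1 d ℝ) {M : ℕ} (hM : 0 < M) (L : ℕ) :
    contourSum L (linAvgAt ρ A M : Form1 d ℝ) = contourSum (M * L) A - dz (blockSum L (LamAt ρ A M)) := by
  rw [linAvgAt_eq, contourSum_sub (N := L), contourSum_dz, ← contourSum_mul M L hM]

/-! ## §2 Two levels: the composite of two rooted averagings is the straight product-block sum minus a coarse-exact form -/

/-- [folklore] **TWO-LEVEL COARSE-EXACTNESS** (X-an3-30's first-order half, for every blocking, roots and dimension): the rooted `L`-average of the rooted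
`M`-average is the straight `M·L`-block-contour sum MINUS THE COARSE GRADIENT of the explicit potential
`ζ = blockSum L (LamAt ρ₀ A M) + LamAt ρ₁ (linAvgAt ρ₀ A M) L`. -/
theorem linAvgAt_linAvgAt_eq (ρ₀ ρ₁ : Fin d → ℤ) (A : Form1 d ℝ) {M : ℕ} (hM : 0 < M) (L : ℕ) :
    (linAvgAt ρ₁ (linAvgAt ρ₀ A M : Form1 d ℝ) L : Form1 d ℝ) =
      contourSum (M * L) A - dz (blockSum L (LamAt ρ₀ A M) + LamAt ρ₁ (linAvgAt ρ₀ A M : Form1 d ℝ) L) := by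
  rw [linAvgAt_eq ρ₁, contourSum_linAvgAt ρ₀ A hM L, dz_add]
  abel

/-! ## §3 The induction clause: coarse-exact defects propagate through further averagings -/

/-- [folklore] **INDUCTION CLAUSE (straight averaging on top)**: if a linear averaging `Φ` at blocking `N` has a COARSE-EXACT defect,
`Φ A = contourSum N A − dz (ζ A)`, then `contourSum L (Φ A) = contourSum (N·L) A − dz (blockSum L (ζ A))`. -/
theorem contourSum_of_coarseExact {Φ : Form1 d ℝ → Form1 d ℝ} {ζ : Form1 d ℝ → Form0 d ℝ} {N : ℕ} (hN : 0 < N)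
    (hΦ : ∀ A, Φ A = contourSum N A - dz (ζ A)) (A : Form1 d ℝ) (L : ℕ) :
    contourSum L (Φ A) = contourSum (N * L) A - dz (blockSum L (ζ A)) := by
  rw [hΦ A, contourSum_sub (N := L), contourSum_dz, ← contourSum_mul N L hN]

/-- [folklore] **INDUCTION CLAUSE (rooted averaging on top)**: if a linear averaging `Φ` at blocking `N` has a COARSE-EXACT defect, `Φ A = contourSum N A − dz (ζ A)`,
then so has the rooted `L`-averaging of its output at blocking `N·L`:
`linAvgAt ρ (Φ A) L = contourSum (N·L) A − dz (blockSum L (ζ A) + LamAt ρ (Φ A) L)`. -/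
theorem linAvgAt_of_coarseExact {Φ : Form1 d ℝ → Form1 d ℝ} {ζ : Form1 d ℝ → Form0 d ℝ} {N : ℕ} (hN : 0 < N)
    (hΦ : ∀ A, Φ A = contourSum N A - dz (ζ A)) (ρ : Fin d → ℤ) (A : Form1 d ℝ) (L : ℕ) :
    (linAvgAt ρ (Φ A) L : Form1 d ℝ) = contourSum (N * L) A - dz (blockSum L (ζ A) + LamAt ρ (Φ A) L) := by
  rw [linAvgAt_eq ρ (Φ A) L, contourSum_of_coarseExact hN hΦ A L, dz_add]
  abel

/-- [folklore] **THREE LEVELS, for the record** (the clause applied once to §2): the triple rooted composite at blockings `M`, `L`, `K` is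
`contourSum (M·L·K) A` minus a coarse-exact form with the displayed potential. -/
theorem linAvgAt_three (ρ₀ ρ₁ ρ₂ : Fin d → ℤ) (A : Form1 d ℝ) {M L : ℕ} (hM : 0 < M) (hL : 0 < L) (K : ℕ) :
    (linAvgAt ρ₂ (linAvgAt ρ₁ (linAvgAt ρ₀ A M : Form1 d ℝ) L : Form1 d ℝ) K : Form1 d ℝ) =
      contourSum (M * L * K) A - dz (blockSum K (blockSum L (LamAt ρ₀ A M) + LamAt ρ₁ (linAvgAt ρ₀ A M : Form1 d ℝ) L)
        + LamAt ρ₂ (linAvgAt ρ₁ (linAvgAt ρ₀ A M : Form1 d ℝ) L : Form1 d ℝ) K) :=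
  linAvgAt_of_coarseExact (Φ := fun A => (linAvgAt ρ₁ (linAvgAt ρ₀ A M : Form1 d ℝ) L : Form1 d ℝ))
    (ζ := fun A => blockSum L (LamAt ρ₀ A M) + LamAt ρ₁ (linAvgAt ρ₀ A M : Form1 d ℝ) L) (Nat.mul_pos hM hL)
    (fun A => linAvgAt_linAvgAt_eq ρ₀ ρ₁ A hM L) ρ₂ A K

end Summit.QuantumFields.BalabanUV.Beta.CompositeAveragingCoarseExact
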